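import Literature.Geometry.Symplectic.GrayStabilityLinear
import Literature.Geometry.Kaehler.ManifoldFormsChart
import Literature.Topology.FourManifolds.SmoothOrientationProd
import Mathlib.Geometry.Manifold.VectorBundle.Tangent
import Mathlib.Geometry.Manifold.ContMDiff.Atlas
import Mathlib.Geometry.Manifold.ContMDiff.NormedSpace
import HarnessLib

/-!
# Gray stability, II: the Moser vector field of a smooth path of contact forms

Topic `Literature/Geometry/Symplectic`; second of the files proving the named fact
`Literature.Geometry.Symplectic.GrayStability` (Gray 1959; Geiges, *An Introduction to Contact
Topology* (2008), Thm. 2.2.2, p. 60) by the Moser trick.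

Geiges (2008), proof of Thm. 2.2.2: the isotopy is the flow of the **time-dependent vector field**
`X_t ∈ ker α_t` solving `α̇_t + i_{X_t} dα_t = μ_t α_t` (eq. (2.2)). Here we build that field on
a `3`-manifold `N` from a family `α : ℝ → MForm (𝓡 3) N ℝ 1` (in the chart-wise vocabulary of
`Literature.Geometry.Kaehler.MForm`), and prove that it is a smooth time-dependent vector field
in the sense consumed by the tree's flow theorem
`Literature.Topology.FourManifolds.exists_ambientIsotopy_of_timeDependent` (a `C^∞` map
`ℝ × N → TN`):

* `GrayMoser.suspend α` — the suspended `1`-form `(t, y) ↦ α_t(y) ∘ pr₂` on `ℝ × N` whose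
  smoothness is the joint-smoothness hypothesis of `GrayStability`;
* `GrayMoser.dotForm α t` — the time derivative `α̇_t`; `GrayMoser.moserField α t y` — the Moser
  vector `X_t(y)` (`GrayStabilityLinear.lean`) of `(α_t(y), dα_t(y), α̇_t(y))`;
* chart representatives on `ℝ × (chart target)`: `chartRep` (`(t, q) ↦ α_t` read in the chart at
  `x₀`), `chartRepDeriv` (its `extDeriv` in `q` = `dα_t` read in the chart,
  `inChart_mextDeriv_eq_chartRepDeriv`), `chartRepDot` (its `t`-derivative = `α̇_t` read in the
  chart, `inChart_dotForm_eq_chartRepDot`), all `C^∞` (`contDiffAt_chartRep`, …), and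
  `moserChart` / `moserScalarChart` — the Moser vector and scalar of the representatives;
* `tangentCoordChange_moserField`: read in the chart at `x₀`, the Moser field IS `moserChart`
  (naturality of the Moser vector, `moserVector_comp`), whence
  `contMDiff_moserField` — **the Moser field is a smooth time-dependent vector field**.

The tangent coordinate changes of the product manifold `ℝ × N` are read off from the tree's
`Literature.Topology.FourManifolds.tangentCoordChange_prod` (`SmoothOrientationProd.lean`).
Everything here is proved; no named facts.

## References

* H. Geiges, *An Introduction to Contact Topology*, CUP (2008), Thm. 2.2.2 and its proof,
  pp. 59–61. [Geiges2008]
-/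

noncomputable section

open scoped Manifold ContDiff Topology
open Set Function Filter Bundle
open Literature.Geometry.Kaehler

namespace Literature.Geometry.Symplectic

/-- Local notation: `𝔼 n` is the model Euclidean space `EuclideanSpace ℝ (Fin n)`. -/
local notation "𝔼 " n:arg => EuclideanSpace ℝ (Fin n)

namespace GrayMoser

/-! ### The product manifold `ℝ × N` for a `3`-manifold `N` -/

variable {N : Type*} [TopologicalSpace N] [ChartedSpace (𝔼 3) N]

/-- The extended chart of `ℝ × N` at `(t₀, x₀)` is `(t, y) ↦ (t, φ_{x₀} y)`. [folklore] -/
theorem extChartAt_rprod_apply (t₀ : ℝ) (x₀ : N) (p : ℝ × N) :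
    extChartAt (𝓘(ℝ, ℝ).prod (𝓡 3)) (t₀, x₀) p = (p.1, extChartAt (𝓡 3) x₀ p.2) := by
  rw [extChartAt_prod, PartialEquiv.prod_coe, extChartAt_model_space_eq_id]
  rfl

/-- The inverse extended chart of `ℝ × N` at `(t₀, x₀)` is `(t, q) ↦ (t, φ_{x₀}⁻¹ q)`. [folklore] -/
theorem extChartAt_rprod_symm_apply (t₀ : ℝ) (x₀ : N) (q : ℝ × 𝔼 3) :
    (extChartAt (𝓘(ℝ, ℝ).prod (𝓡 3)) (t₀, x₀)).symm q =
      (q.1, (extChartAt (𝓡 3) x₀).symm q.2) := by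
  rw [extChartAt_prod, PartialEquiv.prod_symm, PartialEquiv.prod_coe,
    extChartAt_model_space_eq_id]
  rfl

/-- The source of the extended chart of `ℝ × N` at `(t₀, x₀)`. [folklore] -/
theorem extChartAt_rprod_source (t₀ : ℝ) (x₀ : N) :
    (extChartAt (𝓘(ℝ, ℝ).prod (𝓡 3)) (t₀, x₀)).source = univ ×ˢ (extChartAt (𝓡 3) x₀).source := by
  rw [extChartAt_prod, PartialEquiv.prod_source, extChartAt_model_space_eq_id, PartialEquiv.refl_source]

/-- The target of the extended chart of `ℝ × N` at `(t₀, x₀)`. [folklore] -/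
theorem extChartAt_rprod_target (t₀ : ℝ) (x₀ : N) :
    (extChartAt (𝓘(ℝ, ℝ).prod (𝓡 3)) (t₀, x₀)).target = univ ×ˢ (extChartAt (𝓡 3) x₀).target := by
  rw [extChartAt_prod, PartialEquiv.prod_target, extChartAt_model_space_eq_id, PartialEquiv.refl_target]

variable [IsManifold (𝓡 3) ∞ N]

/-- On a chart overlap the tangent coordinate changes `z → x₀ → z` cancel. [folklore] -/
theorem tangentCoordChange_cancel {x₀ z : N} (hz : z ∈ (extChartAt (𝓡 3) x₀).source) (v : 𝔼 3) :
    tangentCoordChange (𝓡 3) x₀ z z (tangentCoordChange (𝓡 3) z x₀ z v) = v := by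
  rw [tangentCoordChange_comp ⟨⟨mem_extChartAt_source z, hz⟩, mem_extChartAt_source z⟩,
    tangentCoordChange_self (mem_extChartAt_source z)]

/-! ### The suspended form and its chart representatives -/

/-- **The suspended `1`-form** of a family `α_t` of `1`-forms on `N`: the `1`-form
`(t, y) ↦ α_t(y) ∘ pr₂` on `ℝ × N`. Its smoothness (`IsSmoothForm (suspend α)`) is the
joint-smoothness hypothesis "`α_t` is a smooth family" of `GrayStability` (Geiges 2008,
Thm. 2.2.2: "a smooth family of contact structures"). [cite: Geiges2008, Thm. 2.2.2] -/
def suspend (α : ℝ → MForm (𝓡 3) N ℝ 1) : MForm (𝓘(ℝ, ℝ).prod (𝓡 3)) (ℝ × N) ℝ 1 :=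
  fun p ↦ (α p.1 p.2).compContinuousLinearMap (ContinuousLinearMap.snd ℝ ℝ (𝔼 3))

/-- **The chart representative of the family** in the chart of `N` at `x₀`:
`chartRep α x₀ (t, q) = (α_t).inChart x₀ q`, a family of `1`-forms on the model space
parametrised by `ℝ × 𝔼 3`. [folklore] -/
def chartRep (α : ℝ → MForm (𝓡 3) N ℝ 1) (x₀ : N) (p : ℝ × 𝔼 3) : (𝔼 3) [⋀^Fin 1]→L[ℝ] ℝ :=
  (α p.1).inChart x₀ p.2

/-- The spatial exterior derivative of the chart representative:
`chartRepDeriv α x₀ (t, q) = d(α_t.inChart x₀)(q)` (Mathlib's `extDeriv`). [folklore] -/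
def chartRepDeriv (α : ℝ → MForm (𝓡 3) N ℝ 1) (x₀ : N) (p : ℝ × 𝔼 3) :
    (𝔼 3) [⋀^Fin 2]→L[ℝ] ℝ :=
  extDeriv (fun q ↦ chartRep α x₀ (p.1, q)) p.2

/-- The time derivative of the chart representative:
`chartRepDot α x₀ (t, q) = ∂_t (α_t.inChart x₀ q)`. [folklore] -/
def chartRepDot (α : ℝ → MForm (𝓡 3) N ℝ 1) (x₀ : N) (p : ℝ × 𝔼 3) :
    (𝔼 3) [⋀^Fin 1]→L[ℝ] ℝ :=
  deriv (fun s ↦ chartRep α x₀ (s, p.2)) p.1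

/-- **The time derivative `α̇_t` of the family**, pointwise: `α̇_t(y) = d/dt α_t(y)` (a curve in
the fixed vector space `T*_y N`). Geiges (2008), Lemma 2.2.1 / proof of Thm. 2.2.2 ("the dot
denotes derivative with respect to `t`"). [cite: Geiges2008, Lemma 2.2.1] -/
def dotForm (α : ℝ → MForm (𝓡 3) N ℝ 1) (t : ℝ) : MForm (𝓡 3) N ℝ 1 :=
  fun y ↦ deriv (fun s ↦ (α s y : (𝔼 3) [⋀^Fin 1]→L[ℝ] ℝ)) t

/-- **The Moser vector field** `X_t(y)` of the family (Geiges 2008, proof of Thm. 2.2.2,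
eq. (2.2)): the Moser vector of the data `(α_t(y), dα_t(y), α̇_t(y))`. [cite: Geiges2008, Thm. 2.2.2 (proof, eq. (2.2))] -/
def moserField (α : ℝ → MForm (𝓡 3) N ℝ 1) (t : ℝ) (y : N) : TangentSpace (𝓡 3) y :=
  moserVector (α t y) (mextDeriv (α t) y) (dotForm α t y)

/-- The Moser vector of the chart representatives (the Moser field read in the chart at `x₀`,
`tangentCoordChange_moserField`). [folklore] -/
def moserChart (α : ℝ → MForm (𝓡 3) N ℝ 1) (x₀ : N) (p : ℝ × 𝔼 3) : 𝔼 3 :=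
  moserVector (chartRep α x₀ p) (chartRepDeriv α x₀ p) (chartRepDot α x₀ p)

/-- The Moser scalar `μ_t` of the chart representatives (Geiges 2008, eq. (2.3)). [cite: Geiges2008, Thm. 2.2.2 (proof, eq. (2.3))] -/
def moserScalarChart (α : ℝ → MForm (𝓡 3) N ℝ 1) (x₀ : N) (p : ℝ × 𝔼 3) : ℝ :=
  moserScalar (chartRep α x₀ p) (chartRepDeriv α x₀ p) (chartRepDot α x₀ p)

variable {α : ℝ → MForm (𝓡 3) N ℝ 1}

/-- The representative of the suspended form in the chart of `ℝ × N` at `(t₀, x₀)` is the chart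
representative of the family composed with `pr₂`. [folklore] -/
theorem inChart_suspend (α : ℝ → MForm (𝓡 3) N ℝ 1) (t₀ : ℝ) (x₀ : N) {q : ℝ × 𝔼 3}
    (hq : q.2 ∈ (extChartAt (𝓡 3) x₀).target) :
    (suspend α).inChart (t₀, x₀) q =
      (chartRep α x₀ q).compContinuousLinearMap (ContinuousLinearMap.snd ℝ ℝ (𝔼 3)) := by
  have hq' : q ∈ (extChartAt (𝓘(ℝ, ℝ).prod (𝓡 3)) (t₀, x₀)).target := by
    rw [extChartAt_rprod_target]
    exact ⟨mem_univ _, hq⟩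
  rw [MForm.inChart_eq_of_mem_target _ hq', chartRep, MForm.inChart_eq_of_mem_target _ hq,
    extChartAt_rprod_symm_apply]
  have hz : (extChartAt (𝓡 3) x₀).symm q.2 ∈ (extChartAt (𝓡 3) x₀).source :=
    (extChartAt (𝓡 3) x₀).map_target hq
  have hr : ((q.1, (extChartAt (𝓡 3) x₀).symm q.2) : ℝ × N) ∈
      (extChartAt (𝓘(ℝ, ℝ).prod (𝓡 3)) (t₀, x₀)).source ∩
        (extChartAt (𝓘(ℝ, ℝ).prod (𝓡 3)) (q.1, (extChartAt (𝓡 3) x₀).symm q.2)).source := by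
    rw [extChartAt_rprod_source, extChartAt_rprod_source]
    exact ⟨⟨mem_univ _, hz⟩, ⟨mem_univ _, mem_extChartAt_source _⟩⟩
  rw [Literature.Topology.FourManifolds.tangentCoordChange_prod hr]
  simp only [suspend]
  ext v
  simp only [ContinuousAlternatingMap.compContinuousLinearMap_apply]
  rfl

/-- **The chart representative of a smooth family is jointly `C^∞`** on `ℝ × (chart target)`:
the smoothness of the suspended form, transported to the chart at `(0, x₀)` and composed with
the inclusion `q ↦ (0, q)` of the model fibre. [folklore] -/
theorem contDiffAt_chartRep (hα : IsSmoothForm (suspend α)) (x₀ : N) {p : ℝ × 𝔼 3}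
    (hp : p.2 ∈ (extChartAt (𝓡 3) x₀).target) : ContDiffAt ℝ ∞ (chartRep α x₀) p := by
  obtain ⟨t, q⟩ := p
  set z := (extChartAt (𝓡 3) x₀).symm q with hz
  have hzs : z ∈ (extChartAt (𝓡 3) x₀).source := (extChartAt (𝓡 3) x₀).map_target hp
  have hqz : extChartAt (𝓡 3) x₀ z = q := (extChartAt (𝓡 3) x₀).right_inv hp
  have h1 : ContDiffWithinAt ℝ ∞ ((suspend α).inChart ((0 : ℝ), x₀))
      (range (𝓘(ℝ, ℝ).prod (𝓡 3)))
      (extChartAt (𝓘(ℝ, ℝ).prod (𝓡 3)) ((0 : ℝ), x₀) (t, z)) :=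
    MForm.SmoothAt.contDiffWithinAt_inChart
      (by rw [extChartAt_rprod_source]; exact ⟨mem_univ _, hzs⟩) (hα (t, z))
  rw [extChartAt_rprod_apply, ModelWithCorners.range_eq_univ, contDiffWithinAt_univ] at h1
  simp only [hqz] at h1
  have h2 : ContDiffAt ℝ ∞ (⇑(ContinuousAlternatingMap.compContinuousLinearMapCLM (ι := Fin 1)
      (F := ℝ) (ContinuousLinearMap.inr ℝ ℝ (𝔼 3))) ∘ (suspend α).inChart ((0 : ℝ), x₀)) (t, q) :=
    (ContinuousAlternatingMap.compContinuousLinearMapCLM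
      (ContinuousLinearMap.inr ℝ ℝ (𝔼 3))).contDiff.contDiffAt.comp (t, q) h1
  refine h2.congr_of_eventuallyEq ?_
  have hopen : IsOpen ((univ : Set ℝ) ×ˢ (extChartAt (𝓡 3) x₀).target) :=
    isOpen_univ.prod (isOpen_extChartAt_target x₀)
  filter_upwards [hopen.mem_nhds ⟨mem_univ _, hp⟩] with r hr
  rw [comp_apply, ContinuousAlternatingMap.compContinuousLinearMapCLM_apply, inChart_suspend α 0 x₀ hr.2]
  ext v
  simp only [ContinuousAlternatingMap.compContinuousLinearMap_apply]
  rfl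

/-- The chart representative is `C^∞` in the space variable for fixed time. [folklore] -/
theorem contDiffAt_chartRep_slice (hα : IsSmoothForm (suspend α)) (x₀ : N) (t : ℝ) {q : 𝔼 3}
    (hq : q ∈ (extChartAt (𝓡 3) x₀).target) :
    ContDiffAt ℝ ∞ (fun q' ↦ chartRep α x₀ (t, q')) q :=
  (contDiffAt_chartRep hα x₀ (p := (t, q)) hq).comp q (contDiffAt_const.prodMk contDiffAt_id)

/-- **Each form `α_t` of a smooth family is a smooth form.** [folklore] -/
theorem smoothAt_slice (hα : IsSmoothForm (suspend α)) (t : ℝ) (z : N) : (α t).SmoothAt z := by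
  have h := contDiffAt_chartRep_slice hα z t (mem_extChartAt_target (I := 𝓡 3) z)
  exact h.contDiffWithinAt

/-- Each form `α_t` of a smooth family is a smooth form. [folklore] -/
theorem isSmoothForm_slice (hα : IsSmoothForm (suspend α)) (t : ℝ) : IsSmoothForm (α t) :=
  fun z ↦ smoothAt_slice hα t z

/-- **`dα_t` read in the chart at `x₀` is the exterior derivative of the representative**
(chart formula for `d` on the whole chart, `inChart_mextDeriv_of_mem_target`). [folklore] -/
theorem inChart_mextDeriv_eq_chartRepDeriv (hα : IsSmoothForm (suspend α)) (x₀ : N) {t : ℝ}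
    {q : 𝔼 3} (hq : q ∈ (extChartAt (𝓡 3) x₀).target) :
    (mextDeriv (α t)).inChart x₀ q = chartRepDeriv α x₀ (t, q) := by
  rw [inChart_mextDeriv_of_mem_target (α t) hq (smoothAt_slice hα t _),
    ModelWithCorners.range_eq_univ, extDerivWithin_univ]
  rfl

/-- **The family is differentiable in time at each point**, with derivative `α̇_t(y)`. [folklore] -/
theorem hasDerivAt_apply (hα : IsSmoothForm (suspend α)) (t : ℝ) (z : N) :
    HasDerivAt (fun s ↦ (α s z : (𝔼 3) [⋀^Fin 1]→L[ℝ] ℝ)) (dotForm α t z) t := by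
  have h : (fun s ↦ (α s z : (𝔼 3) [⋀^Fin 1]→L[ℝ] ℝ)) =
      fun s ↦ chartRep α z (s, extChartAt (𝓡 3) z z) := by
    funext s
    exact ((α s).inChart_apply_self z).symm
  have hd : DifferentiableAt ℝ (fun s ↦ chartRep α z (s, extChartAt (𝓡 3) z z)) t :=
    ((contDiffAt_chartRep hα z (p := (t, extChartAt (𝓡 3) z z))
      (mem_extChartAt_target z)).comp t (contDiffAt_id.prodMk contDiffAt_const)).differentiableAt
      (by simp)
  show HasDerivAt (fun s ↦ (α s z : (𝔼 3) [⋀^Fin 1]→L[ℝ] ℝ))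
    (deriv (fun s ↦ (α s z : (𝔼 3) [⋀^Fin 1]→L[ℝ] ℝ)) t) t
  rw [h]
  exact hd.hasDerivAt

/-- **`α̇_t` read in the chart at `x₀` is the time derivative of the representative.** [folklore] -/
theorem inChart_dotForm_eq_chartRepDot (hα : IsSmoothForm (suspend α)) (x₀ : N) {t : ℝ}
    {q : 𝔼 3} (hq : q ∈ (extChartAt (𝓡 3) x₀).target) :
    (dotForm α t).inChart x₀ q = chartRepDot α x₀ (t, q) := by
  rw [MForm.inChart_eq_of_mem_target _ hq]
  have h : ∀ s, chartRep α x₀ (s, q) =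
      (α s ((extChartAt (𝓡 3) x₀).symm q)).compContinuousLinearMap
        (tangentCoordChange (𝓡 3) x₀ ((extChartAt (𝓡 3) x₀).symm q)
          ((extChartAt (𝓡 3) x₀).symm q)) :=
    fun s ↦ MForm.inChart_eq_of_mem_target _ hq
  simp only [chartRepDot, h]
  exact (((ContinuousAlternatingMap.compContinuousLinearMapCLM (ι := Fin 1) (F := ℝ)
    (tangentCoordChange (𝓡 3) x₀ ((extChartAt (𝓡 3) x₀).symm q)
      ((extChartAt (𝓡 3) x₀).symm q))).hasFDerivAt).comp_hasDerivAt t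
    (hasDerivAt_apply hα t ((extChartAt (𝓡 3) x₀).symm q))).deriv.symm

/-- The exterior derivative of the representative is jointly `C^∞`. [folklore] -/
theorem contDiffAt_chartRepDeriv (hα : IsSmoothForm (suspend α)) (x₀ : N) {p : ℝ × 𝔼 3}
    (hp : p.2 ∈ (extChartAt (𝓡 3) x₀).target) : ContDiffAt ℝ ∞ (chartRepDeriv α x₀) p := by
  obtain ⟨t, q⟩ := p
  have h1 : ContDiffAt ℝ ∞
      (fun p' : ℝ × 𝔼 3 ↦ fderiv ℝ (fun q' ↦ chartRep α x₀ (p'.1, q')) p'.2) (t, q) := by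
    refine ContDiffAt.fderiv (n := ∞) (m := ∞) ?_ contDiffAt_snd (by simp)
    exact (contDiffAt_chartRep hα x₀ (p := (t, q)) hp).comp ((t, q), q)
      ((contDiffAt_fst.comp _ contDiffAt_fst).prodMk contDiffAt_snd)
  exact (ContinuousAlternatingMap.alternatizeUncurryFinCLM ℝ (𝔼 3) ℝ).contDiff.contDiffAt.comp
    (t, q) h1

/-- The time derivative of the representative is jointly `C^∞`. [folklore] -/
theorem contDiffAt_chartRepDot (hα : IsSmoothForm (suspend α)) (x₀ : N) {p : ℝ × 𝔼 3}
    (hp : p.2 ∈ (extChartAt (𝓡 3) x₀).target) : ContDiffAt ℝ ∞ (chartRepDot α x₀) p := by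
  obtain ⟨t, q⟩ := p
  have h1 : ContDiffAt ℝ ∞
      (fun p' : ℝ × 𝔼 3 ↦ fderiv ℝ (fun s ↦ chartRep α x₀ (s, p'.2)) p'.1) (t, q) := by
    refine ContDiffAt.fderiv (n := ∞) (m := ∞) ?_ contDiffAt_fst (by simp)
    exact (contDiffAt_chartRep hα x₀ (p := (t, q)) hp).comp ((t, q), t)
      (contDiffAt_snd.prodMk (contDiffAt_snd.comp _ contDiffAt_fst))
  have h2 : chartRepDot α x₀ =
      fun p' ↦ fderiv ℝ (fun s ↦ chartRep α x₀ (s, p'.2)) p'.1 1 := rfl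
  rw [h2]
  exact h1.clm_apply contDiffAt_const

/-- **The contact condition in the chart**: `vol (α_t) (dα_t) ≠ 0` for the representatives, from
the contact condition `α_t ∧ dα_t ≠ 0` on `N`. [folklore] -/
theorem vol_chartRep_ne_zero (hα : IsSmoothForm (suspend α))
    (hc : ∀ t y, ∃ u v w, wedge₁₂ (α t y) (mextDeriv (α t) y) u v w ≠ 0) (x₀ : N)
    {p : ℝ × 𝔼 3} (hp : p.2 ∈ (extChartAt (𝓡 3) x₀).target) :
    vol (chartRep α x₀ p) (chartRepDeriv α x₀ p) ≠ 0 := by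
  obtain ⟨t, q⟩ := p
  have hzs : (extChartAt (𝓡 3) x₀).symm q ∈ (extChartAt (𝓡 3) x₀).source :=
    (extChartAt (𝓡 3) x₀).map_target hp
  have h1 : chartRep α x₀ (t, q) = (α t ((extChartAt (𝓡 3) x₀).symm q)).compContinuousLinearMap
      (tangentCoordChange (𝓡 3) x₀ ((extChartAt (𝓡 3) x₀).symm q)
        ((extChartAt (𝓡 3) x₀).symm q)) :=
    MForm.inChart_eq_of_mem_target _ hp
  have h2 : chartRepDeriv α x₀ (t, q) =
      (mextDeriv (α t) ((extChartAt (𝓡 3) x₀).symm q)).compContinuousLinearMap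
        (tangentCoordChange (𝓡 3) x₀ ((extChartAt (𝓡 3) x₀).symm q)
          ((extChartAt (𝓡 3) x₀).symm q)) := by
    rw [← inChart_mextDeriv_eq_chartRepDeriv hα x₀ hp, MForm.inChart_eq_of_mem_target _ hp]
  rw [h1, h2]
  exact vol_comp_ne_zero _ _ ((vol_ne_zero_iff _ _).2 (hc t _)) (tangentCoordChange_cancel hzs)

/-- **The Moser field read in a chart is the Moser vector of the chart representatives**
(naturality of the Moser vector under the tangent coordinate change, `moserVector_comp`): for
`z` in the source of the chart at `x₀`,
`tangentCoordChange z x₀ z (X_t(z)) = moserChart α x₀ (t, φ_{x₀} z)`. [cite: Geiges2008, Thm. 2.2.2 (proof)] -/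
theorem tangentCoordChange_moserField (hα : IsSmoothForm (suspend α))
    (hc : ∀ t y, ∃ u v w, wedge₁₂ (α t y) (mextDeriv (α t) y) u v w ≠ 0) (x₀ : N) {t : ℝ}
    {z : N} (hz : z ∈ (extChartAt (𝓡 3) x₀).source) :
    tangentCoordChange (𝓡 3) z x₀ z (moserField α t z) =
      moserChart α x₀ (t, extChartAt (𝓡 3) x₀ z) := by
  have hq : extChartAt (𝓡 3) x₀ z ∈ (extChartAt (𝓡 3) x₀).target := (extChartAt (𝓡 3) x₀).map_source hz
  have hzq : (extChartAt (𝓡 3) x₀).symm (extChartAt (𝓡 3) x₀ z) = z := (extChartAt (𝓡 3) x₀).left_inv hz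
  have h1 : chartRep α x₀ (t, extChartAt (𝓡 3) x₀ z) =
      (α t z).compContinuousLinearMap (tangentCoordChange (𝓡 3) x₀ z z) := by
    rw [chartRep, MForm.inChart_eq_of_mem_target _ hq, hzq]
  have h2 : chartRepDeriv α x₀ (t, extChartAt (𝓡 3) x₀ z) =
      (mextDeriv (α t) z).compContinuousLinearMap (tangentCoordChange (𝓡 3) x₀ z z) := by
    rw [← inChart_mextDeriv_eq_chartRepDeriv hα x₀ hq, MForm.inChart_eq_of_mem_target _ hq, hzq]
  have h3 : chartRepDot α x₀ (t, extChartAt (𝓡 3) x₀ z) =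
      (dotForm α t z).compContinuousLinearMap (tangentCoordChange (𝓡 3) x₀ z z) := by
    rw [← inChart_dotForm_eq_chartRepDot hα x₀ hq, MForm.inChart_eq_of_mem_target _ hq, hzq]
  rw [moserChart, h1, h2, h3]
  exact (moserVector_comp _ _ _ ((vol_ne_zero_iff _ _).2 (hc t z)) (tangentCoordChange_cancel hz)).symm

/-- The Moser vector of the representatives is jointly `C^∞` on `ℝ × (chart target)`. [folklore] -/
theorem contDiffAt_moserChart (hα : IsSmoothForm (suspend α))
    (hc : ∀ t y, ∃ u v w, wedge₁₂ (α t y) (mextDeriv (α t) y) u v w ≠ 0) (x₀ : N)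
    {p : ℝ × 𝔼 3} (hp : p.2 ∈ (extChartAt (𝓡 3) x₀).target) :
    ContDiffAt ℝ ∞ (moserChart α x₀) p := by
  rw [← contDiffWithinAt_univ]
  exact contDiffWithinAt_moserVector (contDiffAt_chartRep hα x₀ hp).contDiffWithinAt
    (contDiffAt_chartRepDeriv hα x₀ hp).contDiffWithinAt
    (contDiffAt_chartRepDot hα x₀ hp).contDiffWithinAt (vol_chartRep_ne_zero hα hc x₀ hp)

/-- The Moser scalar of the representatives is jointly `C^∞` on `ℝ × (chart target)`. [folklore] -/
theorem contDiffAt_moserScalarChart (hα : IsSmoothForm (suspend α))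
    (hc : ∀ t y, ∃ u v w, wedge₁₂ (α t y) (mextDeriv (α t) y) u v w ≠ 0) (x₀ : N)
    {p : ℝ × 𝔼 3} (hp : p.2 ∈ (extChartAt (𝓡 3) x₀).target) :
    ContDiffAt ℝ ∞ (moserScalarChart α x₀) p := by
  rw [← contDiffWithinAt_univ]
  exact contDiffWithinAt_moserScalar (contDiffAt_chartRep hα x₀ hp).contDiffWithinAt
    (contDiffAt_chartRepDeriv hα x₀ hp).contDiffWithinAt
    (contDiffAt_chartRepDot hα x₀ hp).contDiffWithinAt (vol_chartRep_ne_zero hα hc x₀ hp)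

omit [IsManifold (𝓡 3) ∞ N] in
/-- The Moser vector of the representatives lies in the kernel of the representative:
`α̂(X̂) = 0`. [cite: Geiges2008, Thm. 2.2.2 (proof)] -/
theorem chartRep_apply_moserChart (α : ℝ → MForm (𝓡 3) N ℝ 1) (x₀ : N) (p : ℝ × 𝔼 3) :
    chartRep α x₀ p ![moserChart α x₀ p] = 0 :=
  apply_moserVector _ _ _

/-- **The Moser equation (2.2) in the chart**: `α̂̇(w) + dα̂(X̂, w) = μ̂ · α̂(w)`. [cite: Geiges2008, Thm. 2.2.2 (proof, eq. (2.2))] -/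
theorem moser_identity_chart (hα : IsSmoothForm (suspend α))
    (hc : ∀ t y, ∃ u v w, wedge₁₂ (α t y) (mextDeriv (α t) y) u v w ≠ 0) (x₀ : N)
    {p : ℝ × 𝔼 3} (hp : p.2 ∈ (extChartAt (𝓡 3) x₀).target) (w : 𝔼 3) :
    chartRepDot α x₀ p ![w] + chartRepDeriv α x₀ p ![moserChart α x₀ p, w] =
      moserScalarChart α x₀ p * chartRep α x₀ p ![w] :=
  moser_identity _ _ _ (vol_chartRep_ne_zero hα hc x₀ hp) w

/-- **The Moser field is a smooth time-dependent vector field**: `(t, y) ↦ X_t(y) ∈ T_y N` is a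
`C^∞` map `ℝ × N → TN` (in the trivialization at `x₀` it is `moserChart α x₀`, which is `C^∞`).
This is the form of the hypothesis of the tree's flow theorem
`Literature.Topology.FourManifolds.exists_ambientIsotopy_of_timeDependent`. [cite: Geiges2008, Thm. 2.2.2 (proof)] -/
theorem contMDiff_moserField (hα : IsSmoothForm (suspend α))
    (hc : ∀ t y, ∃ u v w, wedge₁₂ (α t y) (mextDeriv (α t) y) u v w ≠ 0) :
    ContMDiff (𝓘(ℝ, ℝ).prod (𝓡 3)) (𝓡 3).tangent ∞
      (fun p : ℝ × N ↦ (⟨p.2, moserField α p.1 p.2⟩ : TangentBundle (𝓡 3) N)) := by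
  rintro ⟨t₀, x₀⟩
  rw [contMDiffAt_totalSpace]
  refine ⟨contMDiffAt_snd, ?_⟩
  have hev : (fun p : ℝ × N ↦
      (trivializationAt (𝔼 3) (TangentSpace (𝓡 3)) x₀ ⟨p.2, moserField α p.1 p.2⟩).2) =ᶠ[𝓝 (t₀, x₀)]
      fun p ↦ moserChart α x₀ (p.1, extChartAt (𝓡 3) x₀ p.2) := by
    have ho : IsOpen ((univ : Set ℝ) ×ˢ (extChartAt (𝓡 3) x₀).source) :=
      isOpen_univ.prod (isOpen_extChartAt_source x₀)
    filter_upwards [ho.mem_nhds ⟨mem_univ _, mem_extChartAt_source x₀⟩] with p hp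
    rw [TangentBundle.trivializationAt_apply]
    exact tangentCoordChange_moserField hα hc x₀ hp.2
  refine ContMDiffAt.congr_of_eventuallyEq ?_ hev
  have h1 : ContMDiffAt (𝓘(ℝ, ℝ).prod (𝓡 3)) 𝓘(ℝ, ℝ × 𝔼 3) ∞
      (fun p : ℝ × N ↦ (p.1, extChartAt (𝓡 3) x₀ p.2)) (t₀, x₀) :=
    contMDiffAt_fst.prodMk_space ((contMDiffAt_extChartAt (x := x₀)).comp _ contMDiffAt_snd)
  exact ContDiffAt.comp_contMDiffAt (f := fun p : ℝ × N ↦ (p.1, extChartAt (𝓡 3) x₀ p.2))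
    (x := (t₀, x₀)) (contDiffAt_moserChart hα hc x₀ (p := (t₀, extChartAt (𝓡 3) x₀ x₀))
    (mem_extChartAt_target x₀)) h1

end GrayMoser

end Literature.Geometry.Symplectic
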